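import Summits.BirchSwinnertonDyer.BirchSwinnertonDyer.Theorems.ByReductionTypeAtTwoRankOneAtTwoBigImageOddLocalOneDoorBottomCebotarevCopy
import Summits.BirchSwinnertonDyer.BirchSwinnertonDyer.Theorems.ByReductionTypeAtTwoRankOneAtTwoBigImageOddLocalOneDoorHalvesJointDoor
import Summits.BirchSwinnertonDyer.BirchSwinnertonDyer.Theorems.ByReductionTypeAtTwoRankOneAtTwoOneDoorFirstDescentDefs
import Literature.NumberTheory.EllipticCurves.ArtinFormalismQuadraticLocalProofs
import HarnessLib

/-!
# Route ByReductionTypeAtTwo, crux `RankOneAtTwoBigImageOddLocal` (stmt-BirchSwinnertonDyer-23715), LINE v8.9 `one_door_analytic`: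
# the CROSS ČEBOTAREV FIELD `hcross` of the lead's `nonempty_firstDescentInput_neg` — PROVED

Width prover seat `bsd-line-fkl-p2` g10 (2026-08-28), `--supports stmt-BirchSwinnertonDyer-23715` (helper).  THEOREMS ONLY.  BSD is not proved by
any of this.

The lead's assembly `…OneDoorBottomAssemblyNeg.nonempty_firstDescentInput_neg` (g12) builds `FirstDescentInput W Wd` at a `Δ_W < 0` bottom-rung
datum from two displayed inputs: `hcl` (the first-layer classes, item 24880's face) and `hcross` — the full cross Čebotarev field for a MODEL
`Wd = Cd • W^{(d_K)}` with `Kol := KolNeg W K`, `pl := plOfNat`.  `hcross_of_doorAdmissible` below IS `hcross`, verbatim, under the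
assembly's habitat binders: transport `s ∈ H¹(ℚ, Wd[2])` to the twist equation along `Cd` (`h1TorsionIso`; the strict condition corresponds,
`EigenClassesFinite.mem_torsionLocalKer_iff_h1TorsionIso_mem`), then the twin copy of `y` is served by `ceb₁_rat` +
`not_mem_torsionLocalKer_twist_of_copy`, every other class by `ceb₂'_rat` (displayed `hinjK` discharged by `hinjK_of_habitat`); the
habitat facts `d_K` odd and `d_K·(−|Δ_W|)` non-square come from `DoorAdmissible` (`kolyvaginAdmissible_of_doorAdmissible`), `θ` with
`θ² = d_K` from `exists_sq_eq_discr_not_mem_range`.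

References: [McCallumLMS1991] §3 Cor. 3.2 and p. 299; [GrossLMS1991] §§3, 4, 9, 10; [Kolyvagin1989Izv] §3.
-/

set_option autoImplicit false
-- the Theorems namespace of this sub repeats the summit name by design (D-0017 nested layout)
set_option linter.dupNamespace false

noncomputable section

open scoped Classical

namespace Summit.BirchSwinnertonDyer.BirchSwinnertonDyer.Theorems.RankOneAtTwoOneDoor

open WeierstrassCurve NumberField IsDedekindDomain Field Rat.HeightOneSpectrum
open Literature.NumberTheory.EllipticCurves Literature.NumberTheory.GaloisRepresentations
open Summit.BirchSwinnertonDyer.BirchSwinnertonDyer.Theorems.GenusExact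
open Summit.BirchSwinnertonDyer.BirchSwinnertonDyer.Theorems.GenusExact.VisiblePairAtTwo
open Summit.BirchSwinnertonDyer.BirchSwinnertonDyer.Theorems.GenusExact.SelmerDescent
open Summit.BirchSwinnertonDyer.BirchSwinnertonDyer.Theorems.GenusExact.EigenClassesFinite

/-- **The cross Čebotarev field `hcross` of `nonempty_firstDescentInput_neg`, PROVED** (`W` globally minimal, no CM, surjective `2`-adic
tower, `Δ_W < 0`; `K` imaginary quadratic with `DoorAdmissible W d_K`; `Wd = Cd • W^{(d_K)}` any elliptic model): for every `q₀`, every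
`y ≠ 0` in `H¹(ℚ, W[2])` and every `s ≠ 0` in `H¹(ℚ, Wd[2])` there is a Kolyvagin prime `ℓ` (`KolNeg W K ℓ`) with `s ∉ strictAt Wd 2 v_ℓ` and
`y ∉ strictAt W 2 v_ℓ` (the relaxedness hypothesis is not used). [cite: McCallumLMS1991, §3 Cor. 3.2 and p. 299] [cite: GrossLMS1991, Prop. 9.1, §10]
[cite: Kolyvagin1989Izv, §3] -/
theorem hcross_of_doorAdmissible (W : WeierstrassCurve ℚ) [W.IsElliptic] [W.IsGloballyMinimal] [NeZero (W.conductorNorm ℤ)]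
    (hCM : ¬ W.HasCM) (hsurj : ∀ n : ℕ, W.HasSurjectiveModNGaloisRep ((2 ^ n : ℕ) : ℤ))
    (K : Type) [Field K] [NumberField K] (hK : IsImaginaryQuadratic K) (hadm : DoorAdmissible W (NumberField.discr K))
    (Wd : WeierstrassCurve ℚ) [Wd.IsElliptic] (Cd : VariableChange ℚ) (hWd : Cd • W.quadraticTwist (NumberField.discr K : ℚ) = Wd)
    (hΔ : W.Δ < 0) :
    ∀ (q₀ : RatPlace) (y : galH1Torsion W 2) (s : galH1Torsion Wd 2), y ≠ 0 → s ≠ 0 →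
      (∀ w : RatPlace, w ≠ q₀ → s ∈ locAt Wd 2 w) →
      ∃ ℓ, KolNeg W K ℓ ∧ s ∉ strictAt Wd 2 (plOfNat ℓ) ∧ y ∉ strictAt W 2 (plOfNat ℓ) := by
  intro q₀ y s hy0 hs0 _
  have h2K : Module.finrank ℚ K = 2 := hK.1
  have hd0 : ((NumberField.discr K : ℤ) : ℚ) ≠ 0 := by exact_mod_cast NumberField.discr_ne_zero K
  obtain ⟨hodd, -, hns, -⟩ := kolyvaginAdmissible_of_doorAdmissible W hadm
  obtain ⟨θ, hθ, hc⟩ := exists_sq_eq_discr_not_mem_range K h2K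
  haveI : (W.quadraticTwist ((NumberField.discr K : ℤ) : ℚ)).IsElliptic := W.isElliptic_quadraticTwist hd0
  have hinjK := hinjK_of_habitat W K hK hΔ hsurj hns
  -- transport `s` to the twist equation along `Cd`
  set s' : galH1Torsion (W.quadraticTwist ((NumberField.discr K : ℤ) : ℚ)) ((2 : ℕ) : ℤ) := (h1TorsionIso ((2 : ℕ) : ℤ) hWd).symm s
    with hs'_def
  have hs' : h1TorsionIso ((2 : ℕ) : ℤ) hWd s' = s := AddEquiv.apply_symm_apply _ _
  have hs'0 : s' ≠ 0 := fun h => hs0 (by rw [← hs', h, map_zero])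
  have hstrict : ∀ v : HeightOneSpectrum (𝓞 ℚ),
      s' ∈ (W.quadraticTwist ((NumberField.discr K : ℤ) : ℚ)).torsionLocalKer (v.adicCompletion ℚ) ((2 : ℕ) : ℤ) ↔
        s ∈ Wd.torsionLocalKer (v.adicCompletion ℚ) ((2 : ℕ) : ℤ) := fun v => by
    rw [mem_torsionLocalKer_iff_h1TorsionIso_mem ((2 : ℕ) : ℤ) (v.adicCompletion ℚ) hWd s', hs']
  by_cases hcopy : hPsiKT W K hθ hc ((2 : ℕ) : ℤ) (resTorsion (W.quadraticTwist ((NumberField.discr K : ℤ) : ℚ)) K ((2 : ℕ) : ℤ) s') =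
      resTorsion W K ((2 : ℕ) : ℤ) y
  · -- the twin copy of `y`: any Kolyvagin prime singular for `y`
    obtain ⟨ℓ, -, hFrob, hKol, hidx, hloc⟩ :=
      ceb₁_rat (W.conductorNorm ℤ) W dvd_rfl hCM hΔ hK hodd hns hsurj hθ hc hinjK y hy0 0
    have hℓ : ℓ.Prime := hKol.1
    have hyv := hloc _ (natCast_mem_primesEquiv_symm hℓ)
    refine ⟨ℓ, ⟨hFrob, hKol, hidx⟩, ?_, ?_⟩
    · rw [plOfNat_of_prime hℓ, strictAt_inl]
      exact fun h => not_mem_torsionLocalKer_twist_of_copy (W.conductorNorm ℤ) W dvd_rfl hΔ hK hodd hθ hc hKol hFrob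
        (natCast_mem_primesEquiv_symm hℓ) s' y hcopy hyv ((hstrict _).2 h)
    · rw [plOfNat_of_prime hℓ, strictAt_inl]
      exact hyv
  · -- the generic case
    obtain ⟨ℓ, -, hFrob, hKol, hidx, hloc⟩ :=
      ceb₂'_rat (W.conductorNorm ℤ) W dvd_rfl hCM hΔ hK hodd hns hsurj hθ hc hinjK s' y hs'0 hy0 hcopy 0
    have hℓ : ℓ.Prime := hKol.1
    refine ⟨ℓ, ⟨hFrob, hKol, hidx⟩, ?_, ?_⟩
    · rw [plOfNat_of_prime hℓ, strictAt_inl]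
      exact fun h => (hloc _ (natCast_mem_primesEquiv_symm hℓ)).1 ((hstrict _).2 h)
    · rw [plOfNat_of_prime hℓ, strictAt_inl]
      exact (hloc _ (natCast_mem_primesEquiv_symm hℓ)).2

end Summit.BirchSwinnertonDyer.BirchSwinnertonDyer.Theorems.RankOneAtTwoOneDoor

end
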